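import Mathlib
import Summits.ResolutionOfSingularities.ResolutionOfSingularities.Theorems.WildQuotientsWildQuotientResolutionCyclicTransferLocFixed
import Summits.ResolutionOfSingularities.ResolutionOfSingularities.Theorems.WildQuotientsWildQuotientResolutionCyclicTransferLocFixedRegular
import Summits.ResolutionOfSingularities.ResolutionOfSingularities.Theorems.WildQuotientsWildQuotientResolutionCyclicTransferLocFreeFlat
import Literature.AlgebraicGeometry.Resolution.RegularLocalRingsFlatDescent

/-!
# Cyclic divisorial transfer — assembly of the local algebra
(crux stmt-ResolutionOfSingularities-15640 `WildQuotients.WildQuotientResolution`, line `Sketch`,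
registered stub `isRegularRing_eqLocus`)

`B` a regular domain, `σ ≠ 1` a ring automorphism of prime order `p`, `A = B^σ = eqLocus σ id`
Noetherian, and at every `σ`-fixed prime `𝔮` of `B` the augmentation ideal `(σ b - b : b ∈ B)`
becomes principal in `B_𝔮` (the Király–Lütkebohmert terminal state). Then `A` is a regular ring.

Proof: `B` is integral over `A` (invariants of the finite group `⟨σ⟩`), so every prime `𝔭` of `A`
is `𝔮 ∩ A` for a prime `𝔮` of `B` (lying over). If `σ𝔮 = 𝔮`, then `A_𝔭 ≅ (B_𝔮)^{σ'}`
(`stub_locFixed`) is regular by Király–Lütkebohmert (`stub_locFixedRegular`). If `σ𝔮 ≠ 𝔮`, then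
`A_𝔭 → B_𝔮` is a flat local homomorphism (`stub_locFreeFlat`, Chase–Harrison–Rosenberg) and
regularity descends (Matsumura 23.7 (i), `IsRegularLocalRing.of_flat_ringHom`).
-/

set_option linter.dupNamespace false

noncomputable section

open IsLocalRing

namespace Summit.ResolutionOfSingularities.ResolutionOfSingularities.Theorems.WildQuotientResolution.CyclicTransfer

/-- `B` is integral over the fixed subring `A = B^σ` of an automorphism `σ` of finite order
(`σ ^ p = 1`, `0 < p`): every `b` is a root of the monic polynomial `∏_{g ∈ ⟨σ⟩} (X - g b) ∈ A[X]`.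
[folklore; Bourbaki AC V §1 no. 9 Prop. 22] -/
theorem isIntegral_eqLocus {B : Type} [CommRing B] {p : ℕ} (hp : 0 < p) (σ : B ≃+* B)
    (hσp : σ ^ p = RingEquiv.refl B) :
    Algebra.IsIntegral ((σ : B →+* B).eqLocus (RingHom.id B)) B := by
  set A := (σ : B →+* B).eqLocus (RingHom.id B) with hA
  have hfin : IsOfFinOrder σ :=
    isOfFinOrder_iff_pow_eq_one.mpr ⟨p, hp, hσp.trans RingAut.one_eq_refl.symm⟩
  haveI : Finite (Subgroup.zpowers σ) := Set.finite_coe_iff.mpr hfin.finite_zpowers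
  haveI : Algebra.IsInvariant A B (Subgroup.zpowers σ) := by
    refine ⟨fun b hb => ?_⟩
    have hb1 : σ b = b := hb ⟨σ, Subgroup.mem_zpowers σ⟩
    exact ⟨⟨b, hb1⟩, rfl⟩
  exact Algebra.IsInvariant.isIntegral A B (Subgroup.zpowers σ)

/-- **The local algebra of the cyclic divisorial transfer** (registered stub `isRegularRing_eqLocus`
of crux stmt-ResolutionOfSingularities-15640, line `Sketch`). `B` a regular domain, `σ ≠ 1` an
automorphism of prime order `p` with Noetherian fixed ring `A = B^σ = eqLocus σ id`, such that at
every `σ`-FIXED prime `𝔮` the augmentation ideal `(σ b - b)` becomes principal in `B_𝔮` (the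
Király–Lütkebohmert terminal state). Then `A` is a regular ring: every prime of `A` lies under a
prime `𝔮` of `B` (`B` is integral over `A`); at a fixed `𝔮` by `stub_locFixed` +
Király–Lütkebohmert (`stub_locFixedRegular`), at a moved `𝔮` by flatness (`stub_locFreeFlat`) and
flat local descent of regularity (Matsumura 23.7 (i)).
[cite: KiralyLutkebohmert2013, Thm 2] [cite: Matsumura1987, Thm. 23.7 (i)] -/
theorem isRegularRing_eqLocus {B : Type} [CommRing B] [IsDomain B] [IsRegularRing B] {p : ℕ}
    (hp : p.Prime) (σ : B ≃+* B) (hσ1 : σ ≠ RingEquiv.refl B) (hσp : σ ^ p = RingEquiv.refl B)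
    [IsNoetherianRing ((σ : B →+* B).eqLocus (RingHom.id B))]
    (hdiv : ∀ (𝔮 : Ideal B) [𝔮.IsPrime], 𝔮.comap σ = 𝔮 →
      ((Ideal.span (Set.range fun b : B => σ b - b)).map
        (algebraMap B (Localization.AtPrime 𝔮))).IsPrincipal) :
    IsRegularRing ((σ : B →+* B).eqLocus (RingHom.id B)) := by
  set A := (σ : B →+* B).eqLocus (RingHom.id B) with hA
  haveI : Algebra.IsIntegral A B := isIntegral_eqLocus hp.pos σ hσp
  refine isRegularRing_iff.mpr fun 𝔭 _ => ?_
  -- lying over: `𝔭 = 𝔮 ∩ A` for a prime `𝔮` of `B`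
  obtain ⟨𝔮, -, h𝔮, h𝔮𝔭⟩ := Ideal.exists_ideal_over_prime_of_isIntegral 𝔭 (⊥ : Ideal B)
    (by
      rw [← RingHom.ker_eq_comap_bot, (RingHom.injective_iff_ker_eq_bot _).mp]
      · exact bot_le
      · exact Subtype.val_injective)
  rw [Algebra.algebraMap_ofSubring] at h𝔮𝔭
  subst h𝔮𝔭
  by_cases hfix : 𝔮.comap σ = 𝔮
  · -- totally ramified prime: `A_𝔭 ≅ (B_𝔮)^{σ'}`, regular by Király–Lütkebohmert
    have key : ∀ y : B, y ∈ 𝔮 ↔ σ y ∈ 𝔮 := fun y => by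
      conv_lhs => rw [← hfix]
      exact Ideal.mem_comap
    have hS : 𝔮.primeCompl.map σ.toMonoidHom = 𝔮.primeCompl := by
      apply le_antisymm
      · rintro _ ⟨y, hy, rfl⟩
        exact Ideal.mem_primeCompl_iff.mpr fun hx => Ideal.mem_primeCompl_iff.mp hy ((key y).mpr hx)
      · intro x hx
        refine ⟨σ.symm x, Ideal.mem_primeCompl_iff.mpr fun h => Ideal.mem_primeCompl_iff.mp hx ?_,
          σ.apply_symm_apply x⟩
        simpa only [σ.apply_symm_apply] using (key (σ.symm x)).mp h
    let σ' : Localization.AtPrime 𝔮 ≃+* Localization.AtPrime 𝔮 :=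
      IsLocalization.ringEquivOfRingEquiv (Localization.AtPrime 𝔮) (Localization.AtPrime 𝔮) σ hS
    have hσ' : ∀ b : B, σ' (algebraMap B (Localization.AtPrime 𝔮) b) =
        algebraMap B (Localization.AtPrime 𝔮) (σ b) := fun b =>
      IsLocalization.ringEquivOfRingEquiv_eq hS b
    obtain ⟨hinj, hrange⟩ := stub_locFixed hp σ hσp 𝔮 hfix σ' hσ'
    exact stub_locFixedRegular hp σ hσ1 hσp 𝔮 (hdiv 𝔮 hfix) σ' hσ' hinj hrange
  · -- moved prime: `A_𝔭 → B_𝔮` is flat and local, and regularity descends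
    exact Literature.AlgebraicGeometry.Resolution.IsRegularLocalRing.of_flat_ringHom _
      (stub_locFreeFlat hp σ hσp 𝔮 hfix)

end Summit.ResolutionOfSingularities.ResolutionOfSingularities.Theorems.WildQuotientResolution.CyclicTransfer

end
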